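import Literature.NumberTheory.EllipticCurves.ComplexMultiplicationSingularModuli
import Mathlib.NumberTheory.Modular
import HarnessLib

/-!
# Lattices with complex multiplication by `𝓞_K`, `h(K) = 1`, are homothetic to `𝓞_K`

Topic `NumberTheory/EllipticCurves`; arithmetic layer below the CM-period leaf
`Literature.NumberTheory.EllipticCurves.exists_isCMPeriod_of_j_mem_maximalCMJInvariants` (Coates–Wiles 1977, §1 p. 225:
"Since `𝓞` has class number 1, we can choose `Ω ∈ L` such that `L = Ω𝓞`") of
`Literature/…/ComplexMultiplicationCoatesWiles.lean`, via the table of singular moduli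
(`Literature/…/ComplexMultiplicationSingularModuli.lean`).  Everything here is **proved**.

* `Literature.NumberTheory.EllipticCurves.j_eq_cmPeriodPair_j_of_mul_mem_lattice` : for each of the nine class-number-one
  discriminants `d ∈ cmDiscrs` and every lattice `Λ ⊂ ℂ` (Mathlib `PeriodPair`) with
  `ω_d Λ ⊆ Λ`, `ω_d = (d + √d)/2` (`Literature.NumberTheory.EllipticCurves.cmGen`), one has `j(Λ) = j(Λ_d)`,
  `Λ_d = ℤω_d + ℤ = 𝓞_K` (`Literature.NumberTheory.EllipticCurves.cmPeriodPair`); equivalently (Cox, Thm. 10.9, proved in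
  `LatticeJInvariant.lean`) `Λ = Ω · 𝓞_K` for some `Ω ∈ ℂˣ`.

This is the statement "a proper fractional `𝓞_K`-ideal is principal", i.e. `h(d_K) = 1` for
`d_K ∈ {−3, −4, −7, −8, −11, −19, −43, −67, −163}` (Cox, *Primes of the form x² + ny²*,
Thm. 7.30 (i) with Thm. 10.14 / Cor. 10.20: lattices with `𝓞`-multiplication up to homothety
↔ the ideal class group `C(𝓞)`), proved here by Gauss reduction in the guise of Mathlib's
fundamental domain: `Λ = cΛ_τ` with `τ ∈ 𝒟` (`ModularGroup.exists_smul_mem_fd` and the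
homothety `Λ_{γτ} = (cτ + d)⁻¹Λ_τ`, `PeriodPair.exists_ofUpperHalfPlane_smul_lattice_eq`); then
`ω_d = mτ + k`, `τ = (ω_d − k)/m` with `3m² ≤ |d|`, `|d − 2k| ≤ m` and `m ∣ N(k − ω_d)`
(`Literature.NumberTheory.EllipticCurves.lattice_ofUpperHalfPlane_eq_cmPeriodPair_of_mem_fd`), and a finite check
(`Literature.NumberTheory.EllipticCurves.eq_one_of_cm_reduction`: the reduced forms of these discriminants are principal,
Cox (2.14) and Thm. 2.18) leaves `m = 1`, i.e. `Λ_τ = ℤω_d + ℤ`.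

## References

* D. A. Cox, *Primes of the form x² + ny²*, 2nd ed., Wiley 2013: Thm. 2.8 and (2.14) (reduced
  forms, `h(D) = 1` table), Thm. 7.7, Thm. 7.30 (i), Thm. 10.14, Cor. 10.20.
* J.-P. Serre, *A Course in Arithmetic*, GTM 7, VII §1.2 (fundamental domain of `SL₂(ℤ)`).
* J. Coates, A. Wiles, Invent. Math. 39 (1977), §1 p. 225.
-/

noncomputable section

open scoped UpperHalfPlane MatrixGroups Modular
open Complex

namespace PeriodPair

/-- The CM (or any multiplier) property `ωΛ ⊆ Λ` passes to a homothetic lattice: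
if `Λ = cΛ'` and `ωΛ ⊆ Λ` then `ωΛ' ⊆ Λ'`.  A deliberate dot-notation extension of Mathlib's
`PeriodPair` namespace (like `RealLatticePeriod.lean`). [folklore] -/
theorem mul_mem_lattice_of_lattice_eq_mulLeft {L L' : PeriodPair} {c : ℂ} {hc : c ≠ 0}
    (hLL' : L.lattice = (L'.mulLeft c hc).lattice) {ω : ℂ}
    (h : ∀ x ∈ L.lattice, ω * x ∈ L.lattice) : ∀ x ∈ L'.lattice, ω * x ∈ L'.lattice := by
  intro x hx
  have h1 : c * x ∈ L.lattice := by rw [hLL']; exact mul_mem_mulLeft_lattice.mpr hx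
  have h2 := h _ h1
  rw [hLL', show ω * (c * x) = c * (ω * x) by ring, mul_mem_mulLeft_lattice] at h2
  exact h2

/-- **`SL₂(ℤ)` acts on the lattices `Λ_τ = ℤτ + ℤ` by homotheties**: for `γ = (a b; c d)`,
`Λ_{γτ} = (cτ + d)⁻¹ · Λ_τ` (since `ℤ(aτ + b) + ℤ(cτ + d) = ℤτ + ℤ`, `ad − bc = 1`; Serre,
*A Course in Arithmetic*, VII §2.2; Cox §7.B (7.8)). [folklore] -/
theorem exists_ofUpperHalfPlane_smul_lattice_eq (γ : SL(2, ℤ)) (τ : ℍ) :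
    ∃ (k : ℂ) (hk : k ≠ 0),
      (ofUpperHalfPlane (γ • τ)).lattice = ((ofUpperHalfPlane τ).mulLeft k hk).lattice := by
  have hdet : (γ 0 0 : ℂ) * γ 1 1 - γ 0 1 * γ 1 0 = 1 := by
    have h := Matrix.SpecialLinearGroup.det_coe γ
    rw [Matrix.det_fin_two] at h
    exact_mod_cast h
  have him : (τ : ℂ).im ≠ 0 := τ.im_pos.ne'
  have hcd : (γ 1 0 : ℂ) * τ + γ 1 1 ≠ 0 := by
    intro h0
    have hi := congrArg Complex.im h0
    simp only [add_im, mul_im, intCast_re, intCast_im, zero_mul, add_zero, zero_im,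
      mul_eq_zero, Int.cast_eq_zero] at hi
    have hc : γ 1 0 = 0 := hi.resolve_right him
    have hr := congrArg Complex.re h0
    simp only [hc, Int.cast_zero, zero_mul, zero_add, intCast_re, zero_re, Int.cast_eq_zero] at hr
    have : (γ 0 0 : ℂ) * γ 1 1 - γ 0 1 * γ 1 0 = 0 := by rw [hc, hr]; simp
    rw [hdet] at this
    exact one_ne_zero this
  have hcoe : ((γ • τ : ℍ) : ℂ) = ((γ 0 0 : ℂ) * τ + γ 0 1) / ((γ 1 0 : ℂ) * τ + γ 1 1) := by
    rw [UpperHalfPlane.coe_specialLinearGroup_apply]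
    simp only [algebraMap_int_eq, Int.coe_castRingHom, ofReal_intCast]
  refine ⟨((γ 1 0 : ℂ) * τ + γ 1 1)⁻¹, inv_ne_zero hcd, ?_⟩
  ext x
  rw [mem_lattice, mem_mulLeft_lattice, inv_inv, mem_lattice]
  simp only [ofUpperHalfPlane_ω₁, ofUpperHalfPlane_ω₂, mul_one, hcoe]
  constructor
  · rintro ⟨m, n, rfl⟩
    refine ⟨m * γ 0 0 + n * γ 1 0, m * γ 0 1 + n * γ 1 1, ?_⟩
    push_cast
    field_simp
    ring
  · rintro ⟨m, n, hmn⟩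
    refine ⟨m * γ 1 1 - n * γ 1 0, -(m * γ 0 1) + n * γ 0 0, ?_⟩
    have hx : x = ((m : ℂ) * τ + n) / ((γ 1 0 : ℂ) * τ + γ 1 1) := by
      rw [eq_div_iff hcd, mul_comm]; exact hmn.symm
    rw [hx]
    push_cast
    field_simp
    linear_combination ((m : ℂ) * (τ : ℂ) + n) * hdet

end PeriodPair

namespace Literature.NumberTheory.EllipticCurves

open PeriodPair

/-! ### The finite check: reduced forms of the nine discriminants are principal -/

/-- **Reduction step, finite check.**  For `d` one of the nine class-number-one discriminants
(`4c = d(d − 1)`), integers `m > 0`, `k` with `3m² ≤ |d|`, `|d − 2k| ≤ m` and `m ∣ N(k − ω_d)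
= k² − dk + c` force `m = 1` — i.e. the only reduced lattice `[1, (ω_d − k)/m]` with
`𝓞_K`-multiplication is `𝓞_K` itself (Cox, *Primes of the form x² + ny²*, (2.14): `h(D) = 1`
for these `D`, via Thm. 2.8 / Thm. 7.7). [cite: Cox2013, §2.A (2.14) and Thm. 2.8] -/
theorem eq_one_of_cm_reduction {d c m k : ℤ} (hd : d ∈ cmDiscrs) (hc : d * (d - 1) = 4 * c)
    (hm : 0 < m) (h3 : 3 * m ^ 2 ≤ -d) (hre : |d - 2 * k| ≤ m)
    (hdiv : m ∣ k * k - d * k + c) : m = 1 := by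
  rw [abs_le] at hre
  obtain ⟨hre1, hre2⟩ := hre
  simp only [cmDiscrs, Finset.mem_insert, Finset.mem_singleton] at hd
  rcases hd with rfl | rfl | rfl | rfl | rfl | rfl | rfl | rfl | rfl
  · nlinarith
  · nlinarith
  · nlinarith
  · nlinarith
  · nlinarith
  · obtain rfl : c = 95 := by omega
    have hm2 : m ≤ 2 := by nlinarith
    interval_cases m
    · rfl
    · exfalso
      have hk1 : -10 ≤ k := by omega
      have hk2 : k ≤ -9 := by omega
      interval_cases k <;> omega
  · obtain rfl : c = 473 := by omega
    have hm2 : m ≤ 3 := by nlinarith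
    interval_cases m
    · rfl
    · exfalso
      have hk1 : -22 ≤ k := by omega
      have hk2 : k ≤ -21 := by omega
      interval_cases k <;> omega
    · exfalso
      have hk1 : -23 ≤ k := by omega
      have hk2 : k ≤ -20 := by omega
      interval_cases k <;> omega
  · obtain rfl : c = 1139 := by omega
    have hm2 : m ≤ 4 := by nlinarith
    interval_cases m
    · rfl
    · exfalso
      have hk1 : -34 ≤ k := by omega
      have hk2 : k ≤ -33 := by omega
      interval_cases k <;> omega
    · exfalso
      have hk1 : -35 ≤ k := by omega
      have hk2 : k ≤ -32 := by omega
      interval_cases k <;> omega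
    · exfalso
      have hk1 : -35 ≤ k := by omega
      have hk2 : k ≤ -32 := by omega
      interval_cases k <;> omega
  · obtain rfl : c = 6683 := by omega
    have hm2 : m ≤ 7 := by nlinarith
    interval_cases m
    · rfl
    all_goals
      exfalso
      have hk1 : -85 ≤ k := by omega
      have hk2 : k ≤ -78 := by omega
      interval_cases k <;> omega

/-! ### Reduced CM lattices -/

/-- **A reduced lattice with `𝓞_K`-multiplication is `𝓞_K`.**  Let `d ∈ cmDiscrs` and let
`τ` lie in the standard fundamental domain `𝒟` of `SL₂(ℤ)` (Mathlib `ModularGroup.fd`).  If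
`ω_d Λ_τ ⊆ Λ_τ` (`Λ_τ = ℤτ + ℤ`, `ω_d = (d + √d)/2`), then `Λ_τ = ℤω_d + ℤ = Λ_d`: indeed
`ω_d = mτ + k` and `ω_d τ ∈ Λ_τ` give `τ = (ω_d − k)/m` with `m > 0`, `m ∣ N(k − ω_d)`, and
`τ ∈ 𝒟` gives `3m² ≤ 4m²(Im τ)² = |d|`, `|d − 2k| = 2m|Re τ| ≤ m`; the finite check
`eq_one_of_cm_reduction` leaves `m = 1` (Cox, *Primes of the form x² + ny²*, Thm. 2.8 with
(2.14), and §7.B). [cite: Cox2013, Thm. 2.8 and (2.14)] -/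
theorem lattice_ofUpperHalfPlane_eq_cmPeriodPair_of_mem_fd {d : ℤ} (hd : d ∈ cmDiscrs) {τ : ℍ}
    (hτ : τ ∈ ModularGroup.fd)
    (h : ∀ x ∈ (ofUpperHalfPlane τ).lattice, cmGen d * x ∈ (ofUpperHalfPlane τ).lattice) :
    (ofUpperHalfPlane τ).lattice = (cmPeriodPair d).lattice := by
  obtain ⟨hdneg, c, hc⟩ := neg_and_exists_of_mem_cmDiscrs hd
  set ω : ℂ := cmGen d with hω
  have him : ω.im = Real.sqrt (-(d : ℝ)) / 2 := cmGen_im d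
  have hre : ω.re = (d : ℝ) / 2 := cmGen_re d
  have him0 : 0 < ω.im := cmGen_im_pos hdneg
  have hsq : ω ^ 2 = (d : ℂ) * ω - (c : ℂ) := cmGen_sq hdneg.le hc
  -- `ω = mτ + k`, `ωτ = m'τ + k'`
  obtain ⟨m, k, hmk⟩ := mem_lattice.mp (h 1 (by simpa using (ofUpperHalfPlane τ).ω₂_mem_lattice))
  obtain ⟨m', k', hmk'⟩ := mem_lattice.mp (h τ (ofUpperHalfPlane τ).ω₁_mem_lattice)
  simp only [ofUpperHalfPlane_ω₁, ofUpperHalfPlane_ω₂, mul_one] at hmk hmk'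
  -- hmk : m * τ + k = ω ; hmk' : m' * τ + k' = ω * τ
  have hm0 : m ≠ 0 := by
    rintro rfl
    have hi := congrArg Complex.im hmk
    simp only [Int.cast_zero, zero_mul, zero_add, intCast_im] at hi
    exact him0.ne hi
  have hτ_eq : (τ : ℂ) = (ω - k) / m := by
    rw [eq_div_iff (Int.cast_ne_zero.mpr hm0), ← hmk]; ring
  have hτim : (τ : ℂ).im = ω.im / m := by
    rw [hτ_eq, div_intCast_im, sub_im, intCast_im, sub_zero]
  have hτre : (τ : ℂ).re = ((d : ℝ) / 2 - k) / m := by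
    rw [hτ_eq, div_intCast_re, sub_re, intCast_re, hre]
  -- `m > 0`
  have hmpos : 0 < m := by
    have h1 : 0 < ω.im / (m : ℝ) := by rw [← hτim]; exact τ.im_pos
    have h2 : (0 : ℝ) < m := by
      rcases le_or_gt (m : ℝ) 0 with hle | hlt
      · exact absurd (div_nonpos_of_nonneg_of_nonpos him0.le hle) (not_le.mpr h1)
      · exact hlt
    exact_mod_cast h2
  -- `3m² ≤ -d`
  have h3 : 3 * m ^ 2 ≤ -d := by
    have h1 := ModularGroup.three_le_four_mul_im_sq_of_mem_fd hτ
    have h2 : (τ : ℂ).im = UpperHalfPlane.im τ := rfl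
    rw [← h2, hτim, him] at h1
    have hs : Real.sqrt (-(d : ℝ)) ^ 2 = -(d : ℝ) :=
      Real.sq_sqrt (by exact_mod_cast (neg_nonneg.mpr hdneg.le))
    have hm' : (0 : ℝ) < m := by exact_mod_cast hmpos
    have h4 : 4 * (Real.sqrt (-(d : ℝ)) / 2 / (m : ℝ)) ^ 2 = -(d : ℝ) / (m : ℝ) ^ 2 := by
      field_simp
      rw [hs]
      ring
    rw [h4, le_div_iff₀ (by positivity)] at h1
    exact_mod_cast h1
  -- `|d - 2k| ≤ m`
  have hre' : |d - 2 * k| ≤ m := by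
    have h1 : |UpperHalfPlane.re τ| ≤ 1 / 2 := hτ.2
    have h2 : UpperHalfPlane.re τ = (τ : ℂ).re := rfl
    rw [h2, hτre, abs_div, abs_of_pos (by exact_mod_cast hmpos : (0 : ℝ) < m),
      div_le_iff₀ (by exact_mod_cast hmpos : (0 : ℝ) < m)] at h1
    have h3 : |(d : ℝ) - 2 * k| ≤ m := by
      rw [show (d : ℝ) - 2 * k = 2 * ((d : ℝ) / 2 - k) by ring, abs_mul, abs_of_pos two_pos]
      linarith
    have h4 : (|d - 2 * k| : ℝ) = |((d - 2 * k : ℤ) : ℝ)| := by push_cast; ring_nf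
    have h5 : |((d - 2 * k : ℤ) : ℝ)| ≤ m := by rw [← h4]; exact h3
    rw [← Int.cast_abs] at h5
    exact_mod_cast h5
  -- `m ∣ k² - dk + c`
  have hdiv : m ∣ k * k - d * k + c := by
    have e1 : ((d : ℂ) - k - m') * ω = (c : ℂ) - m' * k + k' * m := by
      have e2 : ω * (ω - k) = m' * (ω - k) + k' * m := by
        have hmt : (m : ℂ) * τ = ω - k := by linear_combination hmk
        linear_combination (-(m : ℂ)) * hmk' - (ω - m') * hmt
      linear_combination e2 - hsq
    have hi := congrArg Complex.im e1
    simp only [mul_im, sub_im, sub_re, intCast_im, intCast_re, sub_zero, zero_mul, add_zero,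
      add_im, mul_zero] at hi
    have hm' : (d : ℝ) - k - m' = 0 := by
      rcases mul_eq_zero.mp hi with h0 | h0
      · exact h0
      · exact absurd h0 him0.ne'
    have hm'' : m' = d - k := by
      have : ((d - k - m' : ℤ) : ℝ) = 0 := by push_cast; exact hm'
      have := Int.cast_eq_zero.mp this
      omega
    have e3 : (c : ℂ) - m' * k + k' * m = 0 := by
      rw [← e1, show (d : ℂ) - k - m' = ((d - k - m' : ℤ) : ℂ) by push_cast; ring,
        show d - k - m' = 0 by omega]
      simp
    have e4 : c - m' * k + k' * m = 0 := by exact_mod_cast e3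
    refine ⟨-k', ?_⟩
    rw [hm''] at e4
    linear_combination e4
  -- the finite check: `m = 1`, so `τ = ω - k`
  have hm1 : m = 1 := eq_one_of_cm_reduction hd hc hmpos h3 hre' hdiv
  rw [hm1, Int.cast_one, div_one] at hτ_eq
  ext x
  rw [mem_lattice, mem_lattice]
  simp only [ofUpperHalfPlane_ω₁, ofUpperHalfPlane_ω₂, mul_one, cmPeriodPair_ω₁ hdneg,
    cmPeriodPair_ω₂, hτ_eq]
  constructor
  · rintro ⟨a, b, rfl⟩
    exact ⟨a, b - a * k, by push_cast; ring⟩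
  · rintro ⟨a, b, rfl⟩
    exact ⟨a, b + a * k, by push_cast; ring⟩

/-! ### The main theorem -/

/-- **Lattices with `𝓞_K`-multiplication are homothetic to `𝓞_K` (class number one), in terms
of `j`.**  For `d ∈ cmDiscrs` (the nine fundamental discriminants with `h(d) = 1`) and a
lattice `Λ` with `ω_d Λ ⊆ Λ`, `ω_d = (d + √d)/2`, one has `j(Λ) = j(Λ_d)`, `Λ_d = ℤω_d + ℤ = 𝓞_K`;
by Cox Thm. 10.9 (`PeriodPair.j_eq_iff`) this says `Λ = Ω·𝓞_K` for some `Ω ∈ ℂˣ` — "since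
`𝓞` has class number 1, we can choose `Ω` with `L = Ω𝓞`" (Coates–Wiles 1977, §1 p. 225; Cox,
Thm. 7.30 (i), Thm. 10.14, Cor. 10.20).  Proof: `Λ = cΛ_τ`, move `τ` into `𝒟`
(`ModularGroup.exists_smul_mem_fd`, `PeriodPair.exists_ofUpperHalfPlane_smul_lattice_eq`), and
apply `lattice_ofUpperHalfPlane_eq_cmPeriodPair_of_mem_fd`.
[cite: Cox2013, Thm. 7.30 (i) with Cor. 10.20] -/
theorem j_eq_cmPeriodPair_j_of_mul_mem_lattice {d : ℤ} (hd : d ∈ cmDiscrs) {L : PeriodPair}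
    (h : ∀ x ∈ L.lattice, cmGen d * x ∈ L.lattice) : L.j = (cmPeriodPair d).j := by
  obtain ⟨τ, c₁, hc₁, hL⟩ := L.exists_lattice_eq_mulLeft_ofUpperHalfPlane
  obtain ⟨γ, hγ⟩ := ModularGroup.exists_smul_mem_fd τ
  obtain ⟨k, hk, hγτ⟩ := exists_ofUpperHalfPlane_smul_lattice_eq γ τ
  have h1 : ∀ x ∈ (ofUpperHalfPlane τ).lattice, cmGen d * x ∈ (ofUpperHalfPlane τ).lattice :=
    mul_mem_lattice_of_lattice_eq_mulLeft hL h
  have h2 : ∀ x ∈ (ofUpperHalfPlane (γ • τ)).lattice,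
      cmGen d * x ∈ (ofUpperHalfPlane (γ • τ)).lattice := by
    refine mul_mem_lattice_of_lattice_eq_mulLeft (c := k⁻¹) (hc := inv_ne_zero hk) ?_ h1
    ext x
    rw [mem_mulLeft_lattice, inv_inv, hγτ, mul_mem_mulLeft_lattice]
  have h3 := lattice_ofUpperHalfPlane_eq_cmPeriodPair_of_mem_fd hd hγ h2
  calc L.j = ((ofUpperHalfPlane τ).mulLeft c₁ hc₁).j := j_eq_of_lattice_eq hL
    _ = (ofUpperHalfPlane τ).j := j_mulLeft _ c₁ hc₁
    _ = ((ofUpperHalfPlane τ).mulLeft k hk).j := (j_mulLeft _ k hk).symm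
    _ = (ofUpperHalfPlane (γ • τ)).j := (j_eq_of_lattice_eq hγτ).symm
    _ = (cmPeriodPair d).j := j_eq_of_lattice_eq h3

/-- **Corollary (the form used for the singular moduli).**  If a lattice `Λ` with
`j(Λ) = j₀` admits the multiplication `ω_d Λ ⊆ Λ`, `d ∈ cmDiscrs`, then `j(Λ_d) = j₀`:
the row `j(𝓞_K) = j₀` of the table of singular moduli follows from any one CM lattice with
that `j`-invariant. [cite: Cox2013, Thm. 7.30 (i) with Cor. 10.20] -/
theorem cmPeriodPair_j_eq_of_mul_mem_lattice {d : ℤ} (hd : d ∈ cmDiscrs) {L : PeriodPair}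
    (h : ∀ x ∈ L.lattice, cmGen d * x ∈ L.lattice) {j₀ : ℂ} (hj : L.j = j₀) :
    (cmPeriodPair d).j = j₀ := by
  rw [← j_eq_cmPeriodPair_j_of_mul_mem_lattice hd h, hj]

end Literature.NumberTheory.EllipticCurves

end
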